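import Literature.Probability.RandomPlanarGeometry.StarHullCanonical
import HarnessLib

/-!
# `L` is additive under subordination: `L_A = L_{A'} + L_Q` for `*`-hulls `A' ⊆ A`

G. F. Lawler, O. Schramm, W. Werner, *Conformal restriction: the chordal case*, J. Amer. Math.
Soc. **16** (2003), §2 p. 8 (Semigroups) and §5: for `*`-hulls `A' ⊆ A` the smaller hull divides
the larger one, `Φ_A = Φ_Q ∘ Φ_{A'}` on `ℍ ∖ A` with the quotient hull
`Q = cl Φ_{A'}((A ∖ A') ∩ ℍ)` (`quotientHull`, `HullSubordination.lean`). Expanding the three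
Schwarz-reflected maps at `∞` (`E_B(z) = z + L_B + o(1)`, `tendsto_hullExt_sub_self`,
`L_B = starShift B` of `StarHullCanonical.lean`) gives the additivity of the hydrodynamic
constant: `z + L_A = (z + L_{A'}) + L_Q + o(1)`, i.e.

* `starShift_eq_add_starShift_quotientHull` — `L_A = L_{A'} + L_Q`,
  `Q = quotientHull A A' (starRMap A' hA')` (and its real-part form
  `starShift_re_eq_add_starShift_re_quotientHull`).

On the way: the canonical map `starRMap` has `Φ⁻¹ → 0` at `0` and `Φ⁻¹ → ∞` at `∞`
(`tendsto_starRMap_symm_nhdsWithin_zero`, `tendsto_starRMap_symm_cocompact`), so its quotient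
hull is a `*`-hull (`isStarHull_quotientHull_starRMap`), and `Φ_A = Φ_Q ∘ Φ_{A'}` for the
canonical maps (`starRMap_eq_starRMap_quotientHull_comp`).

## References

* G. F. Lawler, O. Schramm, W. Werner, *Conformal restriction: the chordal case* (2003), §2 p. 8,
  §5 [LawlerSchrammWerner2003Restriction].
* G. F. Lawler, *Conformally Invariant Processes in the Plane* (2005), §3.4 Prop. 3.36, §4.6.1
  [Lawler2005].
-/

noncomputable section

open Set Filter Metric Function
open _root_.Complex _root_.Topology
open UpperHalfPlane (upperHalfPlaneSet)

namespace Literature.Probability.RandomPlanarGeometry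

variable {A A' : Set ℂ}

/-! ### The canonical map: behaviour of the inverse at `0` and `∞` -/

/-- `Φ_{A}⁻¹ → ∞` at `∞` for the canonical map `starRMap`. [folklore] -/
theorem tendsto_starRMap_symm_cocompact (hA : IsStarHull A) :
    Tendsto (starRMap A hA).symm (cocompact ℂ ⊓ 𝓟 upperHalfPlaneSet) (cocompact ℂ) :=
  (isRestrictionMap_starRMap hA).tendsto_symm_cocompact hA

/-- `Φ_{A}⁻¹ → 0` at `0` (inside `ℍ`) for the canonical map `starRMap` (transferred from the map
of `IsStarHull.exists_restrictionMap_tendsto` by uniqueness of restriction maps). [folklore] -/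
theorem tendsto_starRMap_symm_nhdsWithin_zero (hA : IsStarHull A) :
    Tendsto (starRMap A hA).symm (𝓝[upperHalfPlaneSet] 0) (𝓝 0) := by
  obtain ⟨Φ₀, hΦ₀, h0, -, -⟩ := hA.exists_restrictionMap_tendsto
  have hΦ := isRestrictionMap_starRMap hA
  have heq : EqOn (starRMap A hA).symm Φ₀.symm upperHalfPlaneSet := fun w hw ↦ by
    have hz := Φ₀.symm_mapsTo hw
    have h1 : starRMap A hA (Φ₀.symm w) = w := by
      rw [IsRestrictionMap.unique hA hΦ₀ hΦ hz]; exact Φ₀.apply_symm_apply hw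
    calc (starRMap A hA).symm w = (starRMap A hA).symm (starRMap A hA (Φ₀.symm w)) := by rw [h1]
      _ = Φ₀.symm w := (starRMap A hA).symm_apply_apply hz
  refine h0.congr' ?_
  filter_upwards [self_mem_nhdsWithin] with w hw using (heq hw).symm

/-- **The quotient hull of the canonical map is a `*`-hull.**
[cite: LawlerSchrammWerner2003Restriction, §2 p. 8 (Semigroups)] -/
theorem isStarHull_quotientHull_starRMap (hA : IsStarHull A) (hA' : IsStarHull A')
    (hsub : A' ⊆ A) :
    IsStarHull (quotientHull A A' (starRMap A' hA')) :=
  hA.isStarHull_quotientHull hsub (tendsto_starRMap_symm_nhdsWithin_zero hA')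
    (tendsto_starRMap_symm_cocompact hA')

/-! ### `Φ_A = Φ_Q ∘ Φ_{A'}` for the canonical maps -/

/-- Transport of the uniqueness of `Φ_A` along a set equality `C = A`. [folklore] -/
private theorem starRMap_eq_of_eq (hA : IsStarHull A) {C : Set ℂ} (hC : C = A)
    {Ψ : ConformalEquiv (upperHalfPlaneSet \ C) upperHalfPlaneSet} (hΨ : IsRestrictionMap C Ψ)
    {f : ℂ → ℂ} (hf : ∀ z ∈ upperHalfPlaneSet \ C, Ψ z = f z) :
    ∀ z ∈ upperHalfPlaneSet \ A, starRMap A hA z = f z := by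
  subst hC
  intro z hz
  rw [← hf z hz, IsRestrictionMap.unique hA hΨ (isRestrictionMap_starRMap hA) hz]

/-- **`Φ_A = Φ_Q ∘ Φ_{A'}` on `ℍ ∖ A`** for the canonical maps, `Q = cl Φ_{A'}((A ∖ A') ∩ ℍ)` the
quotient hull (`A = Q · A'` in the semigroup `𝒬*`).
[cite: LawlerSchrammWerner2003Restriction, §2 p. 8 (Semigroups)] -/
theorem starRMap_eq_starRMap_quotientHull_comp (hA : IsStarHull A) (hA' : IsStarHull A')
    (hsub : A' ⊆ A) {z : ℂ} (hz : z ∈ upperHalfPlaneSet \ A) :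
    starRMap A hA z = starRMap (quotientHull A A' (starRMap A' hA'))
      (isStarHull_quotientHull_starRMap hA hA' hsub) (starRMap A' hA' z) := by
  set Φ' := starRMap A' hA' with hΦ'def
  have hΦ' : IsRestrictionMap A' Φ' := isRestrictionMap_starRMap hA'
  have hQ : IsStarHull (quotientHull A A' Φ') :=
    isStarHull_quotientHull_starRMap hA hA' hsub
  have hΦQ := isRestrictionMap_starRMap hQ
  have hprod : RestrictionConfig.IsHullProduct (quotientHull A A' Φ') A' A :=
    ⟨hA, Φ', hΦ', hA.diff_eq_setOf_quotientHull hsub⟩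
  have hP : hullProduct (quotientHull A A' Φ') A' Φ' = A :=
    hprod.hullProduct_eq hA' hQ hΦ'
  have hPmap := hΦQ.hullProduct hQ.isBoundedHull.isClosed hA'.isBoundedHull.isClosed hΦ'
  exact starRMap_eq_of_eq hA hP hPmap (fun w _ ↦ hullProductMap_apply _ _ w) z hz

/-! ### Additivity of `L` -/

/-- **`L` is additive under subordination**: for `*`-hulls `A' ⊆ A`,
`L_A = L_{A'} + L_Q` with `Q = cl Φ_{A'}((A ∖ A') ∩ ℍ)` the quotient hull of the canonical map
(`Φ_A = Φ_Q ∘ Φ_{A'}`; expand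
`E_A(z) = E_Q(Φ_{A'}(z)) = Φ_{A'}(z) + L_Q + o(1) = z + L_{A'} + L_Q + o(1)` as `z → ∞` inside
`ℍ ∖ A`). This is the bookkeeping of the constant in the image driving function
`W̃_t = W_t + L_A − L_{B_t}` of [LSW] §5.
[cite: LawlerSchrammWerner2003Restriction, §2 p. 8 (Semigroups) with §5] -/
theorem starShift_eq_add_starShift_quotientHull {A A' : Set ℂ} (hA : IsStarHull A)
    (hA' : IsStarHull A') (hsub : A' ⊆ A) :
    starShift A = starShift A' + starShift (quotientHull A A' (starRMap A' hA')) := by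
  set Φ' := starRMap A' hA' with hΦ'def
  have hΦ' : IsRestrictionMap A' Φ' := isRestrictionMap_starRMap hA'
  have hQ : IsStarHull (quotientHull A A' Φ') :=
    isStarHull_quotientHull_starRMap hA hA' hsub
  set ΦQ := starRMap (quotientHull A A' Φ') hQ with hΦQdef
  have hΦQ : IsRestrictionMap (quotientHull A A' Φ') ΦQ := isRestrictionMap_starRMap hQ
  have hΦ := isRestrictionMap_starRMap hA
  rw [starShift_eq hA, starShift_eq hA', starShift_eq hQ]
  -- the filter `z → ∞` inside `ℍ ∖ A`
  haveI : NeBot (cocompact ℂ ⊓ 𝓟 (upperHalfPlaneSet \ A)) :=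
    hA.isBoundedHull.neBot_cocompact_inf
  have h1 : Tendsto (fun z ↦ hullExt (starRMap A hA) z - z)
      (cocompact ℂ ⊓ 𝓟 (upperHalfPlaneSet \ A)) (𝓝 (hullShift (starRMap A hA))) :=
    (tendsto_hullExt_sub_self hA.isBoundedHull hΦ).mono_left inf_le_left
  have h2 : Tendsto (fun z ↦ hullExt Φ' z - z) (cocompact ℂ ⊓ 𝓟 (upperHalfPlaneSet \ A))
      (𝓝 (hullShift Φ')) :=
    (tendsto_hullExt_sub_self hA'.isBoundedHull hΦ').mono_left inf_le_left
  have h3 : Tendsto Φ' (cocompact ℂ ⊓ 𝓟 (upperHalfPlaneSet \ A)) (cocompact ℂ) :=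
    hΦ'.tendsto_cocompact.mono_left
      (inf_le_inf_left _ (principal_mono.2 (Set.sdiff_subset_sdiff_right hsub)))
  have h4 : Tendsto (fun z ↦ hullExt ΦQ (Φ' z) - Φ' z)
      (cocompact ℂ ⊓ 𝓟 (upperHalfPlaneSet \ A)) (𝓝 (hullShift ΦQ)) :=
    (tendsto_hullExt_sub_self hQ.isBoundedHull hΦQ).comp h3
  have h5 := h2.add h4
  -- the two functions agree on `ℍ ∖ A`
  have heq : ∀ᶠ z in cocompact ℂ ⊓ 𝓟 (upperHalfPlaneSet \ A),
      hullExt (starRMap A hA) z - z = (hullExt Φ' z - z) + (hullExt ΦQ (Φ' z) - Φ' z) := by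
    filter_upwards [mem_inf_of_right (mem_principal_self _)] with z hz
    have hz' : z ∈ upperHalfPlaneSet \ A' := ⟨hz.1, fun h ↦ hz.2 (hsub h)⟩
    have hw : Φ' z ∈ upperHalfPlaneSet \ quotientHull A A' Φ' := by
      rw [hA.diff_quotientHull hsub]; exact ⟨z, hz, rfl⟩
    rw [hullExt_of_mem_diff hz, hullExt_of_mem_diff hz', hullExt_of_mem_diff hw,
      starRMap_eq_starRMap_quotientHull_comp hA hA' hsub hz]
    ring
  exact tendsto_nhds_unique (h1.congr' heq) h5

/-- Real-part form of the additivity `L_A = L_{A'} + L_Q` (all three constants are real,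
`starShift_im`). [cite: LawlerSchrammWerner2003Restriction, §2 p. 8 (Semigroups) with §5] -/
theorem starShift_re_eq_add_starShift_re_quotientHull {A A' : Set ℂ} (hA : IsStarHull A)
    (hA' : IsStarHull A') (hsub : A' ⊆ A) :
    (starShift A).re = (starShift A').re + (starShift (quotientHull A A' (starRMap A' hA'))).re := by
  rw [starShift_eq_add_starShift_quotientHull hA hA' hsub, add_re]

end Literature.Probability.RandomPlanarGeometry
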